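import Summits.AtomisticToContinuum.Crystallization.Theses.PalmUnimodularRigidity
import Summits.AtomisticToContinuum.Crystallization.Theorems.PalmUnimodularRigidityMinimiserShellsResidualDefs
import Literature.Probability.Process.PointStationaryLaw
import Literature.MathematicalPhysics.StatisticalMechanics.RootEnergy
import Summits.AtomisticToContinuum.Crystallization.Theorems.PalmUnimodularRigidityMinimiserShellsPricingToPeriodic
import Summits.AtomisticToContinuum.Crystallization.Theorems.PalmUnimodularRigidityMinimiserShellsMeckePricing
import Summits.AtomisticToContinuum.Crystallization.Theorems.PalmUnimodularRigidityMinimiserShellsCapDefs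
import Summits.AtomisticToContinuum.Crystallization.Theorems.PalmUnimodularRigidityMinimiserShellsSlackCertificates
import Summits.AtomisticToContinuum.Crystallization.Theorems.PalmUnimodularRigidityMinimiserShellsCapReduction
import Summits.AtomisticToContinuum.Crystallization.Theorems.PalmUnimodularRigidityMinimiserShellsCapEvent
import Summits.AtomisticToContinuum.Crystallization.Theorems.PalmUnimodularRigidityMinimiserShellsDefectTransportSent
import Summits.AtomisticToContinuum.Crystallization.Theorems.PalmUnimodularRigidityMinimiserShellsDefectTransportReceived
import Summits.AtomisticToContinuum.Crystallization.Theorems.PalmUnimodularRigidityMinimiserShellsSurchargedReceived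
import Summits.AtomisticToContinuum.Crystallization.Theorems.PalmUnimodularRigidityMinimiserShellsCapAssembly

/-!
# Line `octahedral-annulus-mandate` — checked skeleton for crux `MinimiserShells`
(item stmt-AtomisticToContinuum-9225, route `PalmUnimodularRigidity`, rank 2; crux-plan round 2)

Crux (by name, concluded by `MinimiserShells_of` below): every minimising (`E_P[h] ≤ e*`)
point-stationary `δ`-hard-core probability law on rooted configurations of `ℝ³` has, almost surely,
an `(a/100)`-close-packed root shell.

## The line (idea card `Ideas/octahedral-annulus-mandate.md`, triage r2-1 / r2-2: pass "as rows /
first rung", with mandatory re-typing — done here)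

REGIME DECOMPOSITION OF THE CERTIFIED RESIDUAL.  The crux is kernel-sandwiched against the
`1/3`-hard-core periodic first-shell gap (`Residual.minimiserShells_sandwich`:
`ShellGap 0 → MinimiserShells → ∀ θ ∈ (0,1/10], ShellGap θ`).  This line splits `ShellGap 0` by a
COARSE, INTEGER-VALUED order parameter read off the SECOND-kind neighbours of a site — the cap type —
and attacks the tetrahedrally-close-packed regime, where the energy margins are percent-sized:

* `Capped μ` (this file): the root's first shell `F` (atoms within `28/25·a` of the root, `a` = the
  root's own nearest-neighbour distance, required to lie in `[17/20, 21/20]`) is SQUARE-CAPPED: some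
  atom `y` in the window `(6/5, 8/5)·r̄` (`r̄` = mean radius of `F`) has at least FOUR atoms of `F`
  within `28/25·r̄` — it sits over a square of the shell, i.e. in an octahedral interstice.  Every
  Barlow site has six such caps (`√2·a`), the D5h shell of negative 4146 five, a twin / stacking-fault /
  AA-fault site ≥ 3; every tetrahedrally close-packed environment (icosahedral Z12, Frank–Kasper
  Z14/Z15/Z16: A15, C15, σ; bcc) has NONE — second-kind neighbours of TCP order cap triangles
  (planner's check `scratch/capcheck.py`, this seat, reproducing kit j007481 / j020414: fcc/hcp 6 caps;
  bcc, sc, A15 2a/6c, C15 8a/16d, σ 2a/4f/8i/8i′/8j, ico₁₃+20 all capless with ≤ 3 contacts; the Bain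
  path stays capped down to bct `c/a = 1.12` (`e − e* = +3.6 %`) and is capless from `c/a = 1.06`
  (`+4.15 %`); volume-preserving tetragonal strain of fcc capped to 10 % (`+4.4 %`), uniaxial to 10 %
  (`+4.7 %`), simple shear to 20 %; cheapest capless periodic structure found: bct `c/a ≈ 1.06`,
  `e − e* = 2.98e-2 = 4.15 %·|e*|` = the ceiling on the pricing constant `c` below).
* TCP REGIME = `stub_capCertificates` + `stub_meckePricing` + `stub_pricingToPeriodic` (the card's
  lever, re-typed): a FAMILY of two-shell HYBRID certificates — root energy plus the divergence of a
  bounded finite-range bond transfer `t` is `≥ e* − ε` at every `δ`-hard-core root and `≥ e* + c` at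
  every CAPLESS one, with `c = c(δ) > 0` fixed and the far-field slack `ε → 0` as the range `R → ∞`
  (card budget: `ε(R) = C_s R⁻⁴`, `C_s ∈ [0.27, 1.1]`); Mecke kills `E_P[div t]`, so letting `ε → 0`
  gives the slack-free LINEAR PRICING `e* + c·P(root capless) ≤ E_P[h]` (`capPricing_of`), hence the
  card's rung in both forms: a.s. every minimising law is capped at the root (`capMandate_of`), and —
  through uniformly rooted blocks, `stub_pricingToPeriodic` = `PricingContainment` at locality radius 2
  — the PERIODIC CAP GAP `e(Q) ≥ e* + c·(capless fraction)` (`capGap_of`): "Lennard-Jones ground states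
  are nowhere tetrahedrally close-packed", margin class 3–4 % of `|e*|`.
* CAPPED REGIME = `stub_cappedRegimeShellGap` (the residual, declared crux-class; RESHAPED r2 by the lead:
  the crux-plan's `stub_cappedShellGap`, `∀ t ∀ t' ∃ κ`, was equivalent to `Residual.ShellGap 0` itself —
  `cappedShellGap_iff_shellGap_zero` — so its "capped" restriction was idle): for every bad-fraction threshold
  `t` SOME capless tolerance `s > 0` and gap `κ > 0` work for all periodic `1/3`-separated configurations with
  `≥ t·#motif` badly shelled and `< s·#motif` capless motif sites.  This is `Residual.ShellGap 0` restricted to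
  the capped (close-packed-topology) regime, where the binding competitors live (homogeneous strain just past
  `a/100`: `κ ≲ 4.4e-4`, Disproof §5/§8) — the part of the 3-D Lennard-Jones crystal problem this line does NOT
  make easier.  `shellGap_zero_of` glues the two regimes (case split on the capless fraction at `s`,
  `κ' = min(c·s, κ)`), and `Residual.minimiserShells_of_shellGap_zero` (landed, p121752) returns to the crux BY
  NAME.
* LEAD'S LEDGER (a1, cycle 1): vocabulary landed as `Theorems/…CapDefs.lean` (p130560); STUB 2 landed
  (`…MeckePricing.lean`, p130959, registered unfolded form), STUB 3 landed (`…PricingToPeriodic.lean`, p130734);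
  PART (i) OF STUB 1 landed (`…SlackCertificatesA.lean` p131149 + `…SlackCertificates.lean`:
  `SlackCertificates.stub_slackCertificates` — the slack-ε universal certificate EXISTS CONSTRUCTIVELY, from the
  random-grid transport of 9229 plus a uniform boundary-error bound; so the open content of stub 1 is exactly
  the cap margin `c > 0`); STUB 4 reshaped as above.  Open: stub 1 (ii) and stub 4, both energy statements.
* LEAD'S LEDGER (c10, reshape r3): STUB 1 split into `stub_finiteCapInequality` (its energy content in FINITE linear
  form — necessary by `Cap.finite_cap_inequality_of_capPricing`, p131730) and the provable SUFFICIENCY of that finite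
  inequality for the certificates by a defect-surcharged random-grid transport (`stub_capEvent`,
  `stub_defectTransportSent`, `stub_defectTransportReceived`, `stub_surchargedReceived`, `stub_capAssembly`, composed
  sorry-free in `capCertificates_of_finite`); after r3 `FiniteCapInequality ↔ CapCertificates ↔ CapPricing`
  (`finiteCapInequality_iff_capPricing`).  Open after the wave: `stub_finiteCapInequality`, `stub_cappedRegimeShellGap`.

## Disproof.lean obstructions honoured (tree `Cruxes/MinimiserShells/Disproof.lean`, gens 1–3)
* §2a `minimiserShells_false_without_energy`: `E_P[h] ≤ e*` is used in `capMandate_of` and inside the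
  landed `minimiserShells_of_shellGap_zero`.
* §2b/§2c `minimiserShells_false_without_stationarity`, `not_pointwiseMinimiserShells` (which names this
  card): no stub is a transfer-free pointwise certificate — `stub_capCertificates` carries the transfer
  `t` in its statement and `stub_meckePricing` is the Mecke identity applied to `t⁺`, `t⁻`.
* §9 `minimiserShells_false_withLocalMecke` (far comb, landed `Negative/LocalMecke.lean`): a certificate
  of FIXED range `R` only yields pricing with slack `ε(R) > 0`; the slack-free inequality is the limit
  `R → ∞` (quantifier order `∀ δ ∀ ε ∃ R` in `stub_capCertificates`: for fixed `δ` the far comb needs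
  `R ≲ (34 δ)^(-1/6)`, and the `δ`-separated far field beyond `R` is `≥ −C δ⁻³ R⁻³`).
* §3 `minimiserShells_imp_unimodularEnergyLowerBound`: item 9229 is CLOSED in the route file; it is
  moreover re-derived at slack `ε` by part (i) of every certificate.
* §4/§4b `not_minimiserShellsSlack`: no stub is stable under `E ↦ E + s`; exact minimality enters in
  `capMandate_of` (`c·P(capless) ≤ E − e* = 0`) and in the residual.
* §5/§8 `linearPricing_ceiling(_partial)` (landed `Negative/PricingCeiling.lean`): applies to the cap
  pricing with the CAPLESS event: `c ≤ e(Q) − e*` for every a.s.-capless law — bct `c/a = 1.06`: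
  `c ≤ 2.98e-2`; bcc 3.1e-2; relaxed σ 5.6e-2; A15 8.6e-2; C15 1.3e-1 — two orders above the fine
  ceiling 4.4e-4, which binds only `stub_cappedShellGap`.
* §6a–c, §7, §11: all stubs keep `IsProbabilityMeasure`, unit atom masses (`Capped` reads the atom SET),
  genuine re-rooting (`t (θ_y μ) (−y)`), and live on infinite configurations / periodic `Q`.
* Negative 4146 (D5h soft shell) / barrier `DecahedralSoftShell`: the D5h shell is CAPPED (five square
  caps) — this line does not claim to exclude it; it is on the residual's books, as the card says.
-/

noncomputable section

open MeasureTheory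
open scoped ENNReal BigOperators

namespace Summit.AtomisticToContinuum.Crystallization.Cruxes.MinimiserShells.OctahedralAnnulusMandate

open Literature.Probability.Process (IsPointStationaryLaw IsRootedHardCore)
open Literature.MathematicalPhysics.StatisticalMechanics (lennardJones rootEnergy PeriodicConfiguration interactionEnergy)
open Summit.AtomisticToContinuum.Crystallization.Theses.PalmUnimodularRigidity (MinimiserShells)
open Summit.AtomisticToContinuum.Crystallization.Theorems.MinimiserShells.Negative.LoadBearing
  (eStar meanRootEnergy GoodShell)
open Summit.AtomisticToContinuum.Crystallization.Theorems.PalmUnimodularRigidityMinimiserShells.Residual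
  (ShellGap IsSepThird looseBadMotifCount rerooted minimiserShells_of_shellGap_zero)

open Summit.AtomisticToContinuum.Crystallization.Theorems.MinimiserShells.Negative.Rootedness (E3)
open Summit.AtomisticToContinuum.Crystallization.Theorems.PalmUnimodularRigidityMinimiserShells.Cap
  (IsNNDist meanNorm Capped IsTransfer transferDiv caplessMotifCount meanNorm_le capped_of_local
   capped_congr_of_local)
open Summit.AtomisticToContinuum.Crystallization.Theorems.PalmUnimodularRigidityMinimiserShells.EnergyFloor
  (phaseDom rootCell trunc cst transport hcClass)

/-! ## Vocabulary of the line

LANDED (p130560) as `Theorems/PalmUnimodularRigidityMinimiserShellsCapDefs.lean`, namespace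
`…Theorems.PalmUnimodularRigidityMinimiserShells.Cap`, verbatim from the planner's skeleton (so that stub files
under `Theorems/` can import it): `IsNNDist`, `meanNorm`, `Capped` (square-capped root), `IsTransfer`,
`transferDiv`, `caplessMotifCount`, with the locality lemmas `meanNorm_le`, `capped_of_local`,
`capped_congr_of_local` (`Capped` reads only atoms of norm `≤ 2`).  They are OPENED here, not redeclared; the
registered stub signatures below are textually unchanged. -/

/-! ## The four stub STATEMENTS (named; the registered `stub_*` below restate them verbatim) -/

/-- Statement of `stub_capCertificates`. -/
def CapCertificates : Prop :=
  ∀ δ : ℝ, 0 < δ → ∃ c : ℝ, 0 < c ∧ ∀ ε : ℝ, 0 < ε →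
    ∃ R M : ℝ, ∃ t : Measure E3 → E3 → ℝ, IsTransfer R M t ∧
      ∀ μ : Measure E3, IsRootedHardCore δ μ →
        eStar - ε ≤ rootEnergy lennardJones μ + transferDiv t μ ∧
        (¬ Capped μ → eStar + c ≤ rootEnergy lennardJones μ + transferDiv t μ)

/-- Statement of `stub_meckePricing`. -/
def MeckePricing : Prop :=
  ∀ δ : ℝ, 0 < δ → ∀ P : Measure (Measure E3), IsProbabilityMeasure P →
    (∀ᵐ μ ∂P, IsRootedHardCore δ μ) → IsPointStationaryLaw P →
    ∀ R M : ℝ, ∀ t : Measure E3 → E3 → ℝ, IsTransfer R M t →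
    ∀ G : Measure E3 → Prop, ∀ e₀ c₀ : ℝ, 0 ≤ c₀ →
    (∀ μ : Measure E3, IsRootedHardCore δ μ →
        e₀ ≤ rootEnergy lennardJones μ + transferDiv t μ ∧
        (¬ G μ → e₀ + c₀ ≤ rootEnergy lennardJones μ + transferDiv t μ)) →
    e₀ + c₀ * (P {μ | ¬ G μ}).toReal ≤ meanRootEnergy P

/-- Statement of `stub_pricingToPeriodic`. -/
def PricingToPeriodic : Prop :=
  ∀ G : Measure E3 → Prop,
    (∀ μ ν : Measure E3, (∀ w : E3, ‖w‖ ≤ 2 → (μ {w} ≠ 0 ↔ ν {w} ≠ 0)) → (G μ ↔ G ν)) →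
    ∀ c : ℝ, 0 < c →
    (∀ P : Measure (Measure E3), IsProbabilityMeasure P →
      (∀ᵐ μ ∂P, IsRootedHardCore (1 / 3) μ) → IsPointStationaryLaw P →
      eStar + c * (P {μ | ¬ G μ}).toReal ≤ meanRootEnergy P) →
    ∀ Q : PeriodicConfiguration 3, IsSepThird Q → ∀ t : ℝ,
      t * (Q.motif.card : ℝ) ≤ (Nat.card {x : Q.motif // ¬ G (rerooted Q (x : E3))} : ℝ) →
      eStar + c * t ≤ Q.energyPerParticle lennardJones

/-- Statement of the planner's residual stub `stub_cappedShellGap` (crux-plan r2).  RESHAPED by the lead (r2):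
as typed — `∀ t, ∀ t', ∃ κ` — it is EQUIVALENT to the full residual `Residual.ShellGap 0` (take `t' = 2`: the
capless count never exceeds `#motif`, so the capless hypothesis is idle; `cappedShellGap_iff_shellGap_zero`
below), i.e. it did not restrict anything to the capped regime.  Kept as a definition for the record. -/
def CappedShellGap : Prop :=
  ∀ t : ℝ, 0 < t → ∀ t' : ℝ, 0 < t' → ∃ κ : ℝ, 0 < κ ∧
    ∀ Q : PeriodicConfiguration 3, IsSepThird Q →
      t * (Q.motif.card : ℝ) ≤ (looseBadMotifCount 0 Q : ℝ) →
      (caplessMotifCount Q : ℝ) < t' * (Q.motif.card : ℝ) →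
      eStar + κ ≤ Q.energyPerParticle lennardJones

/-- Statement of the RESHAPED residual stub `stub_cappedRegimeShellGap` (lead a1, reshape r2): for every
bad-fraction threshold `t > 0` there are a capless TOLERANCE `s > 0` and a gap `κ > 0` such that every periodic
`1/3`-separated configuration with at least `t·#motif` badly shelled motif sites and FEWER than `s·#motif`
capless ones has `e(Q) ≥ e* + κ`.  This is what the composition actually uses (`shellGap_zero_of`: the
tetrahedrally-close-packed regime `capless ≥ s·#motif` is paid by the cap gap of stubs 1–3 at rate `c·s`), and it
is the honest "capped-regime" piece of `ShellGap 0`: `ShellGap 0 →` it (`cappedRegimeShellGap_of_shellGap_zero`)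
and NOT conversely without the cap gap (mostly-capless configurations are outside its scope). -/
def CappedRegimeShellGap : Prop :=
  ∀ t : ℝ, 0 < t → ∃ s : ℝ, 0 < s ∧ ∃ κ : ℝ, 0 < κ ∧
    ∀ Q : PeriodicConfiguration 3, IsSepThird Q →
      t * (Q.motif.card : ℝ) ≤ (looseBadMotifCount 0 Q : ℝ) →
      (caplessMotifCount Q : ℝ) < s * (Q.motif.card : ℝ) →
      eStar + κ ≤ Q.energyPerParticle lennardJones

/-! ## The four registered stubs -/

/-! ### STUB 1 RESHAPED (lead c10, r3): the finite cap inequality (open) + its SUFFICIENCY for the certificates (provable)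

Lead a1 proved part (i) of `stub_capCertificates` (slack certificates) and the NECESSITY of a linear FINITE CAP
INEQUALITY (`Cap.finite_cap_inequality_of_capPricing`, p131730).  Reshape r3 splits the stub into
* `stub_finiteCapInequality` — the ENERGY content in finite form (open: TCP-exclusion at a 4 %·|e*| margin), verbatim the
  conclusion of `Cap.finite_cap_inequality_of_capPricing`, so that after r3 `CapCertificates ↔ CapPricing ↔ FiniteCapInequality`;
* five PROVABLE stubs building the SUFFICIENCY `FiniteCapInequality → CapCertificates` by a DEFECT-SURCHARGED random-grid
  transport: next to the 9229 transport `EnergyFloor.transport δ L` (each atom sends `(local energy + C_δ)/N_cell` to every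
  cell-mate) the root sends the surcharge `c/N_cell` to every cell-mate `y` whose cell cluster, re-rooted at `y`, is CAPLESS
  (read through a Giry-measurable proxy `B` of `Capped`, `stub_capEvent`).  Per phase: total surcharge SENT =
  `c·#capless(cell)/N_cell` (`stub_defectTransportSent`), total surcharge RECEIVED = `c·1[root capless in its cell]`
  (`stub_defectTransportReceived`), and the finite cap inequality applied to the cell cluster pays for the sent surcharge
  on top of `e* + C_δ` (`stub_surchargedReceived`); `Capped` is local at radius 2 (`Cap.capped_congr_of_local`), so
  "capless in the cell" = "capless" off six phase slabs of width `2/L`; the assembly (`stub_capAssembly`, hypothesis form,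
  the lead's own stub) is `SlackCertificates.certificate_at` with the surcharge: `h + div t ≥ e* − U/(12 vol)` everywhere and
  `≥ e* − U/(12 vol) + c(1 − 12/L)` at capless roots, margin `c/2` after choosing `ρ`, `L`. -/

/-- Statement of `stub_finiteCapInequality` (the finite, linear form of cap pricing; `CapPricing →` it is
`Cap.finite_cap_inequality_of_capPricing`, landed). -/
def FiniteCapInequality : Prop :=
  ∀ δ : ℝ, 0 < δ → ∃ c : ℝ, 0 < c ∧ ∀ (N : ℕ) (y : Fin N → E3), Function.Injective y →
    (∀ i j : Fin N, i ≠ j → δ ≤ dist (y i) (y j)) →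
    (N : ℝ) * eStar + c * (Nat.card {i : Fin N //
        ¬ Capped ((Measure.count : Measure E3).restrict ((fun z => z - y i) '' Set.range y))} : ℝ) ≤
      interactionEnergy lennardJones y

/-- **STUB 1a — the FINITE CAP INEQUALITY (the line's residual ENERGY content in the TCP regime; open, 4 %-class).**
For every hard core `δ > 0` some `c > 0` makes every finite injective `δ`-separated cluster `y : Fin N → ℝ³` satisfy
`N·e* + c·#{i : the cluster re-rooted at y i is capless} ≤ 𝓔_N(y)`.  NECESSARY for the line (it follows from `CapPricing`,
hence from `CapCertificates`, by exact uniform rooting: `Cap.finite_cap_inequality_of_capPricing`, p131730) and, by the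
five stubs below, SUFFICIENT — so after reshape r3 the cap margin of the line is exactly this finite statement.  Why
plausibly true: lone atoms / dimers / surfaces are capless but carry `≥ |e*|·O(1)` excess each (`c ≤ −e* ≈ 0.72` from
`N = 1`); bulk capless (tetrahedrally close-packed) sites cost `≥ 3 %·|e*|` in every computed structure (bct `c/a = 1.06`:
`2.98e-2`, bcc `3.1e-2`, σ `5.6e-2`, A15 `8.6e-2`, C15 `1.3e-1`; kit j007481/j020414); amorphous polytetrahedral packings
sit 3–5 % above `e*` per atom.  Why it might fail / why open: it is a universal lower bound on the Lennard-Jones energy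
landscape of ALL finite clusters at percent resolution relative to the unknown constant `e*` (only `e* ≤ e_hcp` is cheap);
no such bound is in print (Blanc–Lewin 2015 §2.3). -/
theorem stub_finiteCapInequality :
    ∀ δ : ℝ, 0 < δ → ∃ c : ℝ, 0 < c ∧ ∀ (N : ℕ) (y : Fin N → E3), Function.Injective y →
      (∀ i j : Fin N, i ≠ j → δ ≤ dist (y i) (y j)) →
      (N : ℝ) * eStar + c * (Nat.card {i : Fin N //
          ¬ Capped ((Measure.count : Measure E3).restrict ((fun z => z - y i) '' Set.range y))} : ℝ) ≤
        interactionEnergy lennardJones y := by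
  sorry

/-- **STUB 1b — Giry-measurability of the cap event (size M, provable now).**  There is a measurable set `B` of
configurations such that for every FINITE `F ⊆ ℝ³`, `count|F ∈ B ↔ Capped (count|F)`.  Route: the transfer theorem
`Literature.Probability.PointProcesses.exists_measurableSet_count_restrict_mem_iff` (as in `GoodShellMeasurable`) reduces
it to: for every `m`, `{y : Fin m → ℝ³ injective | Capped (count|range y)}` is Borel — a finite Boolean combination, over the
choices of the nearest atom `i₀`, the first-shell index set `I`, the cap atom `j` and a 4-set `J ⊆ I`, of sets cut out by
continuous functions of `y` (`‖y i‖`, `dist (y i) (y j)`, `meanNorm` = `(∑_{i∈I} ‖y i‖)/|I|`) with `<`, `≤`, `≠`. -/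
theorem stub_capEvent :
    ∃ B : Set (Measure E3), MeasurableSet B ∧ ∀ F : Set E3, F.Finite →
      ((Measure.count : Measure E3).restrict F ∈ B ↔ Capped ((Measure.count : Measure E3).restrict F)) :=
  -- LANDED (wave 1, p132707): Theorems/PalmUnimodularRigidityMinimiserShellsCapEvent.lean
  Summit.AtomisticToContinuum.Crystallization.Theorems.PalmUnimodularRigidityMinimiserShells.CapEvent.stub_capEvent

/-- **STUB 1c — the defect transport: joint measurability and mass SENT (size M, provable now).**  For a measurable
event `B`, surcharge `c`, class `δ > 0` and mesh `L > 0`, the DEFECT TRANSPORT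
`dT(μ, y) = ∫_{[0,1)³} 1[y ∈ C_v] · c·1[(μ|C_v re-rooted at y) ∉ B] / μ(C_v) dv` (`C_v = rootCell L v`, through `trunc δ`
so that it is defined and measurable for every measure) is jointly measurable in `(μ, y)` (as `EnergyFloor.measurable_transport`:
`measurable_lintegral_trunc` / `measurable_trunc_apply` for the parametrised restricted-and-shifted configuration, then
`Measurable.lintegral_prod_right'`), and on a rooted `δ`-hard-core configuration its total SENT mass is the phase average of
`c·#{capless cell-mates}/#cell` (Tonelli for `count|S`, `EnergyFloor.lintegral_count_restrict_setLIntegral_comm`, and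
`trunc_of_mem`). -/
theorem stub_defectTransportSent :
    ∀ B : Set (Measure E3), MeasurableSet B → ∀ c δ L : ℝ, 0 < δ → 0 < L →
      Measurable (Function.uncurry fun (μ : Measure E3) (y : E3) =>
        ∫⁻ v in phaseDom, (rootCell L v).indicator (fun w => Bᶜ.indicator (fun _ => ENNReal.ofReal c)
          (((trunc δ μ).restrict (rootCell L v)).map (fun z => z - w)) / trunc δ μ (rootCell L v)) y) ∧
      ∀ μ : Measure E3, IsRootedHardCore δ μ →
        ∫⁻ y, (∫⁻ v in phaseDom, (rootCell L v).indicator (fun w => Bᶜ.indicator (fun _ => ENNReal.ofReal c)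
          (((trunc δ μ).restrict (rootCell L v)).map (fun z => z - w)) / trunc δ μ (rootCell L v)) y) ∂μ =
        ∫⁻ v in phaseDom, (∫⁻ y in rootCell L v, Bᶜ.indicator (fun _ => ENNReal.ofReal c)
          ((μ.restrict (rootCell L v)).map (fun z => z - y)) ∂μ) / μ (rootCell L v) :=
  -- LANDED (wave 1, p132694): Theorems/PalmUnimodularRigidityMinimiserShellsDefectTransportSent.lean
  Summit.AtomisticToContinuum.Crystallization.Theorems.PalmUnimodularRigidityMinimiserShells.DefectTransportSent.stub_defectTransportSent

/-- **STUB 1d — the defect transport: mass RECEIVED (size M, provable now).**  On a rooted `δ`-hard-core configuration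
`μ = count|S` the total defect mass RECEIVED at the root, `∑_{y ∈ S} dT(θ_y μ, −y)`, is `c·vol{v ∈ [0,1)³ : μ|C_v ∉ B}`:
after the phase shift `v ↦ v − L⁻¹y` (`EnergyFloor.setLIntegral_phaseDom_sub`, `rootCell_int_add`) the sender `y` and the
root share the cell `C_v` (`neg_mem_rootCell_iff`, `preimage_sub_rootCell`), the sender's re-rooted cell cluster shifted
back by `+y` is `μ|C_v` itself, and the `#cell` senders each contribute `c·1[μ|C_v ∉ B]/#cell` (swap by
`lintegral_count_restrict_setLIntegral_comm`; `IsRootedHardCore.map_sub` keeps `θ_y μ` in the class, `trunc_of_mem`). -/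
theorem stub_defectTransportReceived :
    ∀ B : Set (Measure E3), MeasurableSet B → ∀ c δ L : ℝ, 0 < δ → 0 < L →
      ∀ μ : Measure E3, IsRootedHardCore δ μ →
        ∫⁻ y, (∫⁻ v in phaseDom, (rootCell L v).indicator (fun w => Bᶜ.indicator (fun _ => ENNReal.ofReal c)
          (((trunc δ (μ.map fun z => z - y)).restrict (rootCell L v)).map (fun z => z - w)) /
            trunc δ (μ.map fun z => z - y) (rootCell L v)) (-y)) ∂μ =
        ∫⁻ v in phaseDom, Bᶜ.indicator (fun _ => ENNReal.ofReal c) (μ.restrict (rootCell L v)) :=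
  -- LANDED (wave 1, p132821): Theorems/PalmUnimodularRigidityMinimiserShellsDefectTransportReceived.lean
  Summit.AtomisticToContinuum.Crystallization.Theorems.PalmUnimodularRigidityMinimiserShells.DefectTransportReceived.stub_defectTransportReceived

/-- **STUB 1e — surcharged periodisation at the root's cell (size M, provable now).**  If the finite inequality
`N·e* + c·#{i : count|((· − y i) '' range y) ∉ B} ≤ 𝓔_N(y)` holds for all finite injective `δ`-separated clusters, then on
every rooted `δ`-hard-core configuration the mass received through the 9229 transport run at a class parameter
`δ₀ ≤ δ` with `−C_{δ₀} ≤ e*` (so that no `ofReal` truncation bites; the assembly takes `δ₀ = min δ (1/20)`) pays, phase by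
phase, for `e* + C_{δ₀}` PLUS the defect surcharge sent:
`vol·(e* + C_{δ₀}) + ∫_v (∑_{y ∈ C_v} c·1[(μ|C_v − y) ∉ B]) / #C_v dv ≤ IN`.  Route: `EnergyFloor.le_lintegral_transport_map` /
`ofReal_le_lintegral_received` verbatim (phase shift, swap, `share_map_sub_eq`, `sum_half_sum_eq_interactionEnergy`;
`IsRootedHardCore.mono` to pass to `δ₀`) with `card_mul_eStar_le` replaced by the hypothesis applied to the enumeration of
the cluster `T_v` (`injective_enum`; `(· − y i) '' range = (· − y i) '' ↑T_v`; `map_sub_count_restrict`,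
`Measure.restrict_restrict`; the `Nat.card` of capless indices is the finite sum of indicators over `T_v`; each
`½∑ V + C_{δ₀} ≥ 0` by `locEnergy_add_cst_nonneg`, and `e* + C_{δ₀} ≥ 0` by hypothesis). -/
theorem stub_surchargedReceived :
    ∀ B : Set (Measure E3), ∀ c δ₀ δ L : ℝ, 0 ≤ c → 0 < δ₀ → δ₀ ≤ δ → 0 < L → -cst δ₀ ≤ eStar →
      (∀ (N : ℕ) (y : Fin N → E3), Function.Injective y → (∀ i j : Fin N, i ≠ j → δ ≤ dist (y i) (y j)) →
        (N : ℝ) * eStar + c * (Nat.card {i : Fin N //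
            (Measure.count : Measure E3).restrict ((fun z => z - y i) '' Set.range y) ∉ B} : ℝ) ≤
          interactionEnergy lennardJones y) →
      ∀ μ : Measure E3, IsRootedHardCore δ μ →
        volume phaseDom * ENNReal.ofReal (eStar + cst δ₀) +
          ∫⁻ v in phaseDom, (∫⁻ y in rootCell L v, Bᶜ.indicator (fun _ => ENNReal.ofReal c)
            ((μ.restrict (rootCell L v)).map (fun z => z - y)) ∂μ) / μ (rootCell L v) ≤
        ∫⁻ y, transport δ₀ L (μ.map fun z => z - y) (-y) ∂μ :=
  -- LANDED (wave 1, p132892): Theorems/PalmUnimodularRigidityMinimiserShellsSurchargedReceived.lean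
  Summit.AtomisticToContinuum.Crystallization.Theorems.PalmUnimodularRigidityMinimiserShells.SurchargedReceived.stub_surchargedReceived

/-- **STUB 1f — ASSEMBLY of the cap certificates from the finite inequality (hypothesis form; size M–L, the lead's own
stub).**  Given a measurable proxy `B` of `Capped` on finite counting measures (1b), the sent/received bookkeeping of the
defect transport (1c, 1d) and the surcharged periodisation (1e), the finite cap inequality with constant `c > 0` at hard
core `δ` yields, for every `ε > 0`, an admissible transfer with `e* − ε ≤ h + div t` at every rooted `δ`-hard-core
configuration and `e* + c/2 ≤ h + div t` at every CAPLESS one.  Route: `t = −vol⁻¹·(min(transport, M₁) + min(dT, M₂))`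
(`IsTransfer`: 1c + `EnergyFloor.measurable_transport`, bounds `SlackCertificatesA.transport_le_of_hc` and `dT ≤ c·vol`,
range `2L`); OUT ≤ vol·(h + C_δ) + U/12 + (defect sent) (`EnergyFloor.setLIntegral_ofReal_locEnergy_le`,
`SlackCertificatesA.errTerm_le_uniform`, 1c), IN ≥ vol·(e* + C_δ) + (defect sent) + c·vol{v : μ|C_v ∉ B} (1e, 1d); off six
phase slabs of width `2/L` the ball `B̄(0,2)` lies in the root's cell (as `SlackCertificatesA.phaseOut_le_of_norm_le`), where
`μ|C_v ∉ B ↔ ¬ Capped μ` by 1b (the cell cluster is finite) and `Cap.capped_congr_of_local`; so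
`h + div t ≥ e* − U/(12·vol) + c·(1 − 12/L)·1[¬ Capped μ]`, and `ρ`, `L` are chosen as in
`SlackCertificates.stub_slackCertificates` with additionally `L ≥ 48`, `U/(12 vol) ≤ min ε (c/4)`.  The transports are run at
the class parameter `δ₀ = min δ (1/20)` (`IsRootedHardCore.mono`), where `−C_{δ₀} ≤ e*` follows from the crude tree bound
`NearFieldConvexity.Negative.LoadBearing.neg_le_eStar` (`−65536²/12 ≤ e*`), so that 1e applies. -/
theorem stub_capAssembly :
    ∀ B : Set (Measure E3), MeasurableSet B →
      (∀ F : Set E3, F.Finite →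
        ((Measure.count : Measure E3).restrict F ∈ B ↔ Capped ((Measure.count : Measure E3).restrict F))) →
      (∀ c δ L : ℝ, 0 < δ → 0 < L →
        Measurable (Function.uncurry fun (μ : Measure E3) (y : E3) =>
          ∫⁻ v in phaseDom, (rootCell L v).indicator (fun w => Bᶜ.indicator (fun _ => ENNReal.ofReal c)
            (((trunc δ μ).restrict (rootCell L v)).map (fun z => z - w)) / trunc δ μ (rootCell L v)) y) ∧
        ∀ μ : Measure E3, IsRootedHardCore δ μ →
          ∫⁻ y, (∫⁻ v in phaseDom, (rootCell L v).indicator (fun w => Bᶜ.indicator (fun _ => ENNReal.ofReal c)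
            (((trunc δ μ).restrict (rootCell L v)).map (fun z => z - w)) / trunc δ μ (rootCell L v)) y) ∂μ =
          ∫⁻ v in phaseDom, (∫⁻ y in rootCell L v, Bᶜ.indicator (fun _ => ENNReal.ofReal c)
            ((μ.restrict (rootCell L v)).map (fun z => z - y)) ∂μ) / μ (rootCell L v)) →
      (∀ c δ L : ℝ, 0 < δ → 0 < L → ∀ μ : Measure E3, IsRootedHardCore δ μ →
        ∫⁻ y, (∫⁻ v in phaseDom, (rootCell L v).indicator (fun w => Bᶜ.indicator (fun _ => ENNReal.ofReal c)
          (((trunc δ (μ.map fun z => z - y)).restrict (rootCell L v)).map (fun z => z - w)) /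
            trunc δ (μ.map fun z => z - y) (rootCell L v)) (-y)) ∂μ =
        ∫⁻ v in phaseDom, Bᶜ.indicator (fun _ => ENNReal.ofReal c) (μ.restrict (rootCell L v))) →
      (∀ c δ₀ δ L : ℝ, 0 ≤ c → 0 < δ₀ → δ₀ ≤ δ → 0 < L → -cst δ₀ ≤ eStar →
        (∀ (N : ℕ) (y : Fin N → E3), Function.Injective y → (∀ i j : Fin N, i ≠ j → δ ≤ dist (y i) (y j)) →
          (N : ℝ) * eStar + c * (Nat.card {i : Fin N //
              (Measure.count : Measure E3).restrict ((fun z => z - y i) '' Set.range y) ∉ B} : ℝ) ≤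
            interactionEnergy lennardJones y) →
        ∀ μ : Measure E3, IsRootedHardCore δ μ →
          volume phaseDom * ENNReal.ofReal (eStar + cst δ₀) +
            ∫⁻ v in phaseDom, (∫⁻ y in rootCell L v, Bᶜ.indicator (fun _ => ENNReal.ofReal c)
              ((μ.restrict (rootCell L v)).map (fun z => z - y)) ∂μ) / μ (rootCell L v) ≤
          ∫⁻ y, transport δ₀ L (μ.map fun z => z - y) (-y) ∂μ) →
      ∀ δ : ℝ, 0 < δ → ∀ c : ℝ, 0 < c →
      (∀ (N : ℕ) (y : Fin N → E3), Function.Injective y → (∀ i j : Fin N, i ≠ j → δ ≤ dist (y i) (y j)) →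
        (N : ℝ) * eStar + c * (Nat.card {i : Fin N //
            ¬ Capped ((Measure.count : Measure E3).restrict ((fun z => z - y i) '' Set.range y))} : ℝ) ≤
          interactionEnergy lennardJones y) →
      ∀ ε : ℝ, 0 < ε → ∃ R M : ℝ, ∃ t : Measure E3 → E3 → ℝ, IsTransfer R M t ∧
        ∀ μ : Measure E3, IsRootedHardCore δ μ →
          eStar - ε ≤ rootEnergy lennardJones μ + transferDiv t μ ∧
          (¬ Capped μ → eStar + c / 2 ≤ rootEnergy lennardJones μ + transferDiv t μ) :=
  -- LANDED (wave 1, p133873; helpers p133111 CapAssemblyA, p133357 CapAssemblyB): Theorems/PalmUnimodularRigidityMinimiserShellsCapAssembly.lean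
  Summit.AtomisticToContinuum.Crystallization.Theorems.PalmUnimodularRigidityMinimiserShells.CapAssembly.stub_capAssembly

/-- **SUFFICIENCY of the finite cap inequality for the cap certificates** (sorry-free composition of stubs 1b–1f):
`FiniteCapInequality → CapCertificates`, with half the finite constant as cap margin. [folklore] -/
theorem capCertificates_of_finite (hfin : FiniteCapInequality) : CapCertificates := by
  intro δ hδ
  obtain ⟨c, hc, hineq⟩ := hfin δ hδ
  obtain ⟨B, hB, hBcap⟩ := stub_capEvent
  exact ⟨c / 2, by positivity, stub_capAssembly B hB hBcap
    (fun c δ L hδ hL => stub_defectTransportSent B hB c δ L hδ hL)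
    (fun c δ L hδ hL => stub_defectTransportReceived B hB c δ L hδ hL)
    (fun c δ₀ δ L hc hδ₀ hle hL hE => stub_surchargedReceived B c δ₀ δ L hc hδ₀ hle hL hE) δ hδ c hc hineq⟩

/-- **STUB 1 of the crux-plan (`CapCertificates`) from the r3 stubs**: the finite cap inequality (1a, open) and its
sufficiency (1b–1f, provable). -/
theorem stub_capCertificates :
    ∀ δ : ℝ, 0 < δ → ∃ c : ℝ, 0 < c ∧ ∀ ε : ℝ, 0 < ε →
      ∃ R M : ℝ, ∃ t : Measure E3 → E3 → ℝ, IsTransfer R M t ∧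
        ∀ μ : Measure E3, IsRootedHardCore δ μ →
          eStar - ε ≤ rootEnergy lennardJones μ + transferDiv t μ ∧
          (¬ Capped μ → eStar + c ≤ rootEnergy lennardJones μ + transferDiv t μ) :=
  capCertificates_of_finite stub_finiteCapInequality

/-- **After r3 the three forms of the TCP-regime energy statement are EQUIVALENT** (read-back, sorry-free modulo the
provable stubs 1b–1f through `capCertificates_of_finite`): `FiniteCapInequality → CapCertificates → CapPricing →
FiniteCapInequality` (`Cap.capPricing_of_capCertificates`, `Cap.finite_cap_inequality_of_capPricing`, p131730). [folklore] -/
theorem finiteCapInequality_iff_capPricing :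
    FiniteCapInequality ↔ Summit.AtomisticToContinuum.Crystallization.Theorems.PalmUnimodularRigidityMinimiserShells.Cap.CapPricing :=
  ⟨fun h => Summit.AtomisticToContinuum.Crystallization.Theorems.PalmUnimodularRigidityMinimiserShells.Cap.capPricing_of_capCertificates
      (capCertificates_of_finite h),
   fun h => Summit.AtomisticToContinuum.Crystallization.Theorems.PalmUnimodularRigidityMinimiserShells.Cap.finite_cap_inequality_of_capPricing h⟩

/-- **PART (i) OF STUB 1 IS PROVED** (lead a1; landed `Theorems/PalmUnimodularRigidityMinimiserShellsSlackCertificates.lean`,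
p131413, with its lemmas in `…SlackCertificatesA.lean`, p131149): the slack-`ε` universal certificate — STUB 1 in
the format `IsTransfer` / `transferDiv` with cap margin `c = 0` — holds for every `δ > 0`, `ε > 0`,
CONSTRUCTIVELY: `t = −vol⁻¹ · min(transport δ L, hard-core bound)` is the random-grid transport of the landed proof
of item 9229 (`EnergyFloor.transport`), made pointwise by a boundary-error bound UNIFORM over `δ`-hard-core
configurations (cut-off `ρ`, then mesh `L`).  So the open content of `stub_capCertificates` is exactly the cap
margin `c > 0` at capless roots (TCP-exclusion pricing), not the certificate format or its part (i). [folklore] -/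
theorem slackCertificates :
    ∀ δ : ℝ, 0 < δ → ∀ ε : ℝ, 0 < ε →
      ∃ R M : ℝ, ∃ t : Measure E3 → E3 → ℝ, IsTransfer R M t ∧
        ∀ μ : Measure E3, IsRootedHardCore δ μ →
          eStar - ε ≤ rootEnergy lennardJones μ + transferDiv t μ :=
  Summit.AtomisticToContinuum.Crystallization.Theorems.PalmUnimodularRigidityMinimiserShells.SlackCertificates.stub_slackCertificates

/-- **STUB 2 — Mecke pricing lemma (size M, provable now; reusable by every certificate line).**
Under a point-stationary probability law a.s. carried by rooted `δ`-hard-core configurations, a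
POINTWISE hybrid certificate `e₀ ≤ h + div t` everywhere, `e₀ + c₀ ≤ h + div t` off `G`, with `t` an
admissible transfer, integrates to the EXPECTATION inequality `e₀ + c₀ · P*(¬G) ≤ E_P[h]`.  Content:
`E_P[div t] = 0` by the Mecke identity applied to `g = t⁺` and `g = t⁻` (both sides finite: `|t| ≤ M`,
range `R`, at most `C (R/δ)³` atoms in range); `h` is bounded on `δ`-hard-core configurations
(`|h| ≤ C(δ)`: finitely many atoms near, `r⁻⁶` tail over a `δ`-separated set), hence `P`-integrable
once `μ ↦ ∫ V dμ` is shown measurable for the Giry σ-algebra; Markov on the measurable function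
`h + div t − e₀ ≥ 0` bounds the OUTER measure of `¬G` (no measurability of `G` needed).  Why it might
fail: only Lean cost (joint measurability of re-rooting `(μ, y) ↦ (θ_y μ, −y)`, as in item 9228). -/
theorem stub_meckePricing :
    ∀ δ : ℝ, 0 < δ → ∀ P : Measure (Measure E3), IsProbabilityMeasure P →
      (∀ᵐ μ ∂P, IsRootedHardCore δ μ) → IsPointStationaryLaw P →
      ∀ R M : ℝ, ∀ t : Measure E3 → E3 → ℝ, IsTransfer R M t →
      ∀ G : Measure E3 → Prop, ∀ e₀ c₀ : ℝ, 0 ≤ c₀ →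
      (∀ μ : Measure E3, IsRootedHardCore δ μ →
          e₀ ≤ rootEnergy lennardJones μ + transferDiv t μ ∧
          (¬ G μ → e₀ + c₀ ≤ rootEnergy lennardJones μ + transferDiv t μ)) →
      e₀ + c₀ * (P {μ | ¬ G μ}).toReal ≤ meanRootEnergy P :=
  -- LANDED (wave 1, p130959; registered as `stub_meckePricing_unfolded`: `IsTransfer` / `transferDiv`
  -- unfolded — definitionally equal): Theorems/PalmUnimodularRigidityMinimiserShellsMeckePricing.lean
  fun δ hδ P hP hcore hstat R M t ht G e₀ c₀ hc₀ h =>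
    Summit.AtomisticToContinuum.Crystallization.Theorems.PalmUnimodularRigidityMinimiserShells.MeckePricing.stub_meckePricing_unfolded
      δ hδ P hP hcore hstat R M t ht G e₀ c₀ hc₀ h

/-- **STUB 3 — pricing a radius-2-local predicate is a periodic crystallization theorem for it
(size M, provable now: `PricingContainment.le_energyPerParticle_of_pricing` with the locality radius
`5/4` replaced by `2`).**  If `G` reads only the atoms of `B̄(0, 2)` and
`e* + c·P{¬G} ≤ E_P[h]` holds for every point-stationary, a.s. `1/3`-hard-core probability law, then
every periodic `Q` with `1/3`-separated points and at least `t·#motif` motif sites failing `G` has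
`e(Q) ≥ e* + c·t`.  Proof route: uniformly rooted laws of the `K³`-blocks of `Q`
(`NecessityBlocks.exists_blocks` with `depth Q 2` deepened so that deep block points see all of
`Q.points ∩ B̄(x, 2)`; `Negative.UniformRooting`; `natCard_le_mul_unifRooted_apply`; `ε → 0`).  Why it
might fail: only Lean cost (the deep-layer bookkeeping of `PeriodicShellGapConverse` at radius 2). -/
theorem stub_pricingToPeriodic :
    ∀ G : Measure E3 → Prop,
      (∀ μ ν : Measure E3, (∀ w : E3, ‖w‖ ≤ 2 → (μ {w} ≠ 0 ↔ ν {w} ≠ 0)) → (G μ ↔ G ν)) →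
      ∀ c : ℝ, 0 < c →
      (∀ P : Measure (Measure E3), IsProbabilityMeasure P →
        (∀ᵐ μ ∂P, IsRootedHardCore (1 / 3) μ) → IsPointStationaryLaw P →
        eStar + c * (P {μ | ¬ G μ}).toReal ≤ meanRootEnergy P) →
      ∀ Q : PeriodicConfiguration 3, IsSepThird Q → ∀ t : ℝ,
        t * (Q.motif.card : ℝ) ≤ (Nat.card {x : Q.motif // ¬ G (rerooted Q (x : E3))} : ℝ) →
        eStar + c * t ≤ Q.energyPerParticle lennardJones :=
  -- LANDED (wave 1, p130734): Theorems/PalmUnimodularRigidityMinimiserShellsPricingToPeriodic.lean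
  Summit.AtomisticToContinuum.Crystallization.Theorems.PalmUnimodularRigidityMinimiserShells.PricingToPeriodic.stub_pricingToPeriodic

/-- **STUB 4 (RESHAPED r2 by the lead) — the CAPPED-REGIME periodic shell gap (the line's RESIDUAL; crux-class,
declared).**  For every `t > 0` there are a capless tolerance `s > 0` and `κ > 0` such that every periodic
configuration of `ℝ³` with `1/3`-separated points, at least `t·#motif` badly shelled motif sites (the crux's
`(a/100)` test, `looseBadMotifCount 0`) but fewer than `s·#motif` CAPLESS ones has `e(Q) ≥ e* + κ`.  The
planner's form (`CappedShellGap`, `∀ t'`) was equivalent to `Residual.ShellGap 0` itself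
(`cappedShellGap_iff_shellGap_zero`); this form is implied by `ShellGap 0`
(`cappedRegimeShellGap_of_shellGap_zero`) and gives it back only together with the cap gap of stubs 1–3
(`shellGap_zero_of`).  It is `ShellGap 0` (bulk 3-D Lennard-Jones crystallization in periodic first-shell form,
Blanc–Lewin 2015 §2.3: open) RESTRICTED to the close-packed-topology regime, where its binding competitors live
(homogeneous strain just past `a/100`: `κ ≲ 4.4e-4`, Disproof §5/§8); no mechanism of this line addresses it.
Why it might fail: false iff capped periodic structures with a fraction `≥ t` of `1 %`-distorted shells come
arbitrarily close to `e*` however small their capless fraction — i.e. iff the crux fails inside the capped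
regime. -/
theorem stub_cappedRegimeShellGap :
    ∀ t : ℝ, 0 < t → ∃ s : ℝ, 0 < s ∧ ∃ κ : ℝ, 0 < κ ∧
      ∀ Q : PeriodicConfiguration 3, IsSepThird Q →
        t * (Q.motif.card : ℝ) ≤ (looseBadMotifCount 0 Q : ℝ) →
        (caplessMotifCount Q : ℝ) < s * (Q.motif.card : ℝ) →
        eStar + κ ≤ Q.energyPerParticle lennardJones := by
  sorry

/-! ## Status of the residual (lead a1): the planner's stub 4 WAS `ShellGap 0`; the reshaped one is a piece of it -/

/-- The capless count never exceeds the motif size. [folklore] -/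
theorem caplessMotifCount_le (Q : PeriodicConfiguration 3) : caplessMotifCount Q ≤ Q.motif.card := by
  unfold caplessMotifCount
  calc Nat.card {x : Q.motif // ¬ Capped (rerooted Q (x : E3))} ≤ Nat.card Q.motif := Finite.card_subtype_le _
    _ = Q.motif.card := by rw [Nat.card_eq_fintype_card, Fintype.card_coe]

/-- **The planner's residual stub was the full residual.**  `CappedShellGap ↔ Residual.ShellGap 0`: at `t' = 2`
the capless hypothesis `capless < 2·#motif` always holds (`caplessMotifCount_le`, `#motif > 0`), so the
"capped" restriction is idle; conversely `ShellGap 0` gives it for every `t'`.  Hence, as registered by the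
crux-plan, stub 4 alone implied the crux (`Residual.minimiserShells_of_shellGap_zero`) and stubs 1–3 were not
load-bearing — the reason for the lead's reshape to `CappedRegimeShellGap`. [folklore] -/
theorem cappedShellGap_iff_shellGap_zero : CappedShellGap ↔ ShellGap 0 := by
  constructor
  · intro h t ht
    obtain ⟨κ, hκ, hgap⟩ := h t ht 2 two_pos
    refine ⟨κ, hκ, fun Q hsep hbad => hgap Q hsep hbad ?_⟩
    have h1 : (caplessMotifCount Q : ℝ) ≤ (Q.motif.card : ℝ) := by exact_mod_cast caplessMotifCount_le Q
    have h2 : (0 : ℝ) < Q.motif.card := by exact_mod_cast Q.motif_nonempty.card_pos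
    linarith
  · intro h t ht _ _
    obtain ⟨κ, hκ, hgap⟩ := h t ht
    exact ⟨κ, hκ, fun Q hsep hbad _ => hgap Q hsep hbad⟩

/-- **The reshaped residual is implied by the full hard-core periodic shell gap** (drop the capless
hypothesis; any tolerance `s` works): `Residual.ShellGap 0 → CappedRegimeShellGap`.  With `shellGap_zero_of`
below: MODULO STUBS 1–3 the reshaped stub 4 is equivalent to `ShellGap 0`, the certified-open residual of the
crux (`Residual.minimiserShells_sandwich`); on its own it is the capped-regime piece only.  Lead handling:
`blocked-on: Residual.ShellGap 0` (class), not waved. [folklore] -/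
theorem cappedRegimeShellGap_of_shellGap_zero (h : ShellGap 0) : CappedRegimeShellGap := by
  intro t ht
  obtain ⟨κ, hκ, hgap⟩ := h t ht
  exact ⟨1, one_pos, κ, hκ, fun Q hsep hbad _ => hgap Q hsep hbad⟩

/-- The planner's form implies the reshaped one (so the reshape WEAKENED stub 4). [folklore] -/
theorem cappedRegimeShellGap_of_cappedShellGap (h : CappedShellGap) : CappedRegimeShellGap :=
  cappedRegimeShellGap_of_shellGap_zero (cappedShellGap_iff_shellGap_zero.1 h)

/-! ## Composition (sorry-free): the rung, the periodic cap gap, `ShellGap 0`, the crux BY NAME -/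

/-- **Slack-free cap pricing from the certificate family** (`ε → 0`): STUB 1 + STUB 2 give, for every
hard core `δ > 0`, a constant `c > 0` with `e* + c·P{root capless} ≤ E_P[h]` for every
point-stationary a.s. `δ`-hard-core probability law. [folklore] -/
theorem capPricing_of (h1 : CapCertificates) (h2 : MeckePricing) :
    ∀ δ : ℝ, 0 < δ → ∃ c : ℝ, 0 < c ∧ ∀ P : Measure (Measure E3), IsProbabilityMeasure P →
      (∀ᵐ μ ∂P, IsRootedHardCore δ μ) → IsPointStationaryLaw P →
      eStar + c * (P {μ | ¬ Capped μ}).toReal ≤ meanRootEnergy P := by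
  intro δ hδ
  obtain ⟨c, hc, hcert⟩ := h1 δ hδ
  refine ⟨c, hc, fun P hP hcore hstat => ?_⟩
  refine le_of_forall_pos_le_add fun ε hε => ?_
  obtain ⟨R, M, t, ht, hpt⟩ := hcert ε hε
  have hp0 : 0 ≤ (P {μ | ¬ Capped μ}).toReal := ENNReal.toReal_nonneg
  have key : eStar - ε + (c + ε) * (P {μ | ¬ Capped μ}).toReal ≤ meanRootEnergy P :=
    h2 δ hδ P hP hcore hstat R M t ht Capped (eStar - ε) (c + ε) (by linarith)
      (fun μ hμ => ⟨(hpt μ hμ).1, fun hG => by have h' := (hpt μ hμ).2 hG; linarith⟩)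
  have hεp : 0 ≤ ε * (P {μ | ¬ Capped μ}).toReal := mul_nonneg hε.le hp0
  nlinarith [key, hεp]

/-- **THE RUNG, measure form (card `SquareCapMandate`, re-typed): minimising laws are almost surely
capped at the root** — from STUB 1 + STUB 2 alone (`c·P(capless) ≤ E_P[h] − e* ≤ 0`; outer-measure
bookkeeping, no measurability of `Capped` needed). [folklore] -/
theorem capMandate_of (h1 : CapCertificates) (h2 : MeckePricing) :
    ∀ δ : ℝ, 0 < δ → ∀ P : Measure (Measure E3), IsProbabilityMeasure P →
      (∀ᵐ μ ∂P, IsRootedHardCore δ μ) → IsPointStationaryLaw P → meanRootEnergy P ≤ eStar →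
      ∀ᵐ μ ∂P, Capped μ := by
  intro δ hδ P hP hcore hstat hE
  obtain ⟨c, hc, hprice⟩ := capPricing_of h1 h2 δ hδ
  have hineq := hprice P hP hcore hstat
  have h1' : c * (P {μ | ¬ Capped μ}).toReal ≤ 0 := by linarith
  have h2' : 0 ≤ (P {μ | ¬ Capped μ}).toReal := ENNReal.toReal_nonneg
  have hzero : (P {μ | ¬ Capped μ}).toReal = 0 := by nlinarith
  rw [ae_iff]
  rcases (ENNReal.toReal_eq_zero_iff _).1 hzero with h0 | htop
  · exact h0
  · exact absurd htop (measure_ne_top P _)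

/-- **THE RUNG, periodic form: the CAP GAP with a linear constant** — STUBS 1–3: every periodic
configuration with `1/3`-separated points and at least `t·#motif` capless motif sites has
`e(Q) ≥ e* + c·t` ("Lennard-Jones ground states are nowhere tetrahedrally close-packed"). [folklore] -/
theorem capGap_of (h1 : CapCertificates) (h2 : MeckePricing) (h3 : PricingToPeriodic) :
    ∃ c : ℝ, 0 < c ∧ ∀ Q : PeriodicConfiguration 3, IsSepThird Q → ∀ t : ℝ,
      t * (Q.motif.card : ℝ) ≤ (caplessMotifCount Q : ℝ) →
      eStar + c * t ≤ Q.energyPerParticle lennardJones := by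
  obtain ⟨c, hc, hprice⟩ := capPricing_of h1 h2 (1 / 3) (by norm_num)
  exact ⟨c, hc, fun Q hQ t ht =>
    h3 Capped (fun _ _ h => capped_congr_of_local h) c hc hprice Q hQ t ht⟩

/-- **Gluing the two regimes**: the cap gap (TCP regime, STUBS 1–3) and the capped-regime shell gap
(reshaped STUB 4) give the full `1/3`-hard-core periodic shell gap `Residual.ShellGap 0` (case split on the
capless fraction at the tolerance `s = s(t)` of stub 4; `κ = min (c·s) κ₂`). [folklore] -/
theorem shellGap_zero_of (h1 : CapCertificates) (h2 : MeckePricing) (h3 : PricingToPeriodic)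
    (h4 : CappedRegimeShellGap) : ShellGap 0 := by
  obtain ⟨c, hc, hgap⟩ := capGap_of h1 h2 h3
  intro t ht
  obtain ⟨s, hs, κ, hκ, hres⟩ := h4 t ht
  refine ⟨min (c * s) κ, lt_min (mul_pos hc hs) hκ, fun Q hsep hbad => ?_⟩
  by_cases hcase : s * (Q.motif.card : ℝ) ≤ (caplessMotifCount Q : ℝ)
  · have h := hgap Q hsep s hcase
    have hmin := min_le_left (c * s) κ
    linarith
  · push Not at hcase
    have h := hres Q hsep hbad hcase
    have hmin := min_le_right (c * s) κ
    linarith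

/-- **`MinimiserShells_of`** — the skeleton theorem: the crux
`Summit.AtomisticToContinuum.Crystallization.Theses.PalmUnimodularRigidity.MinimiserShells` BY NAME
from the REGISTERED stubs — r3: `stub_finiteCapInequality` (open), `stub_capEvent`, `stub_defectTransportSent`,
`stub_defectTransportReceived`, `stub_surchargedReceived`, `stub_capAssembly` (provable; composed sorry-free into
`stub_capCertificates` by `capCertificates_of_finite`), `stub_cappedRegimeShellGap` (open) — and the landed
`stub_meckePricing` / `stub_pricingToPeriodic`, through the sorry-free `shellGap_zero_of` and the landed sufficiency of
the residual `Residual.minimiserShells_of_shellGap_zero` (p121752). -/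
theorem MinimiserShells_of : MinimiserShells :=
  minimiserShells_of_shellGap_zero
    (shellGap_zero_of stub_capCertificates stub_meckePricing stub_pricingToPeriodic stub_cappedRegimeShellGap)

/- The LOGIC of the line is the sorry-free `shellGap_zero_of : CapCertificates → MeckePricing →
PricingToPeriodic → CappedShellGap → ShellGap 0` (axioms propext / Classical.choice / Quot.sound)
followed by the landed `Residual.minimiserShells_of_shellGap_zero : ShellGap 0 → MinimiserShells`;
no second theorem concluding the crux by name is declared, so that the skeleton audit
(`#h21_check_skeleton`) has exactly one candidate. -/

end Summit.AtomisticToContinuum.Crystallization.Cruxes.MinimiserShells.OctahedralAnnulusMandate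

end
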